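import Mathlib
import Literature.NumberTheory.Automorphic.ShimuraCurveRibetTakahashi
import Literature.NumberTheory.EllipticCurves.IsogenyIdProofs

/-!
# The Jacquet–Langlands / Ribet–Takahashi / Pasten package on the printed class, I: lemmas

Helpers `--supports` stmt-ABC-1561 (crux
`Summit.ABC.ABC.Theses.RibetTakahashiSplit.ManyPrimeValuationProduct`, line `jl-zero-cycle-height`,
stub `stub_jlPackage : JLPackage`), consumed by the sequel
`…RibetTakahashiSplitManyPrimeValuationProductJLPackagePrintedClass` (the package on Pasten's
printed class (b.1)/(b.2) from the named facts of
`Literature.NumberTheory.Automorphic.ShimuraCurveRibetTakahashi`). Everything here is elementary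
and PROVED, in the skeleton's vocabulary with its abbreviations unfolded (`multPrimes W` =
`(N.primeFactors).filter (p² ∤ N)`, `discOf D = ∏_{p ∈ D} p`, `IsCoveringSet` = its four clauses):

* arithmetic of covering sets: a product `D' = ∏_{p ∈ D} p` of distinct primes is squarefree with
  `D'.primeFactors = D`, `2^{#D} ≤ D'`, `2^{#D} ≤ d(D')`, `D' ≤ φ(D') 2^{#D}`, `M ≤ ψ(M)`
  (`gamma0Index`), and a covering set `D` of `W` gives an ADMISSIBLE factorisation
  `N = D' · (N/D')` (`IsAdmissibleFactorization`) whose co-level `N/D'` is divisible by the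
  multiplicative primes outside `D` (`admissible_of_isCoveringSet`);
* minimal Shimura parametrisation data exist (`Nat.find`): of `W` itself, and of the isogeny class
  (`ShimuraParametrizationData.IsMinimalFor`);
* the real bookkeeping of Pasten's §16: the multiplicative chain `real_chain`
  (`T ≤ K κ^ω N^{1+η} / ‖s‖²`) and the logarithmic chain `log_chain`
  (`log T ≤ C + (κ+2)η log N + log vol − log ‖s‖²`).
-/

-- `Summit.ABC.ABC` is the mandated summit-side namespace (CONVENTIONS §2); the duplicate is deliberate.
set_option linter.dupNamespace false

noncomputable section

namespace Summit.ABC.ABC.Theorems.ManyPrimeValuationProduct.JLPackage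

open Literature.NumberTheory.Automorphic (ShimuraCurveData ShimuraParametrizationData
  IsAdmissibleFactorization)
open Literature.NumberTheory.EllipticCurves.ModularForms (gamma0Index)

/-! ### Arithmetic of covering sets -/

section Arithmetic

variable {W : WeierstrassCurve ℚ} {D : Finset ℕ}

/-- Members of a set of multiplicative primes are prime. `[folklore]` -/
theorem prime_of_mem
    (hD : D ⊆ (W.conductorNorm ℤ).primeFactors.filter (fun p => ¬ p ^ 2 ∣ W.conductorNorm ℤ))
    {p : ℕ} (hp : p ∈ D) : p.Prime :=
  Nat.prime_of_mem_primeFactors (Finset.mem_filter.mp (hD hp)).1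

/-- Members of a set of multiplicative primes divide the conductor. `[folklore]` -/
theorem dvd_of_mem
    (hD : D ⊆ (W.conductorNorm ℤ).primeFactors.filter (fun p => ¬ p ^ 2 ∣ W.conductorNorm ℤ))
    {p : ℕ} (hp : p ∈ D) : p ∣ W.conductorNorm ℤ :=
  Nat.dvd_of_mem_primeFactors (Finset.mem_filter.mp (hD hp)).1

/-- Members of a set of multiplicative primes divide the conductor exactly once. `[folklore]` -/
theorem not_sq_dvd_of_mem
    (hD : D ⊆ (W.conductorNorm ℤ).primeFactors.filter (fun p => ¬ p ^ 2 ∣ W.conductorNorm ℤ))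
    {p : ℕ} (hp : p ∈ D) : ¬ p ^ 2 ∣ W.conductorNorm ℤ :=
  (Finset.mem_filter.mp (hD hp)).2

/-- The factorisation of a product of distinct primes. `[folklore]` -/
theorem factorization_prod_primes (hD : ∀ p ∈ D, p.Prime) (q : ℕ) :
    (∏ p ∈ D, p).factorization q = if q ∈ D then 1 else 0 := by
  classical
  rw [Nat.factorization_prod (fun p hp => (hD p hp).ne_zero)]
  rw [Finset.sum_apply']
  have : ∀ p ∈ D, (Nat.factorization p) q = if p = q then 1 else 0 := fun p hp => by
    rw [Nat.Prime.factorization (hD p hp)]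
    simp [Finsupp.single_apply]
  rw [Finset.sum_congr rfl this, Finset.sum_ite_eq']

/-- A product of primes is non-zero. `[folklore]` -/
theorem prod_primes_ne_zero (hD : ∀ p ∈ D, p.Prime) : (∏ p ∈ D, p) ≠ 0 :=
  Finset.prod_ne_zero_iff.mpr fun p hp => (hD p hp).ne_zero

/-- A product of distinct primes is squarefree. `[folklore]` -/
theorem squarefree_prod_primes (hD : ∀ p ∈ D, p.Prime) : Squarefree (∏ p ∈ D, p) := by
  rw [Nat.squarefree_iff_factorization_le_one (prod_primes_ne_zero hD)]
  intro q
  rw [factorization_prod_primes hD]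
  split_ifs <;> simp

/-- The prime factors of `∏_{p ∈ D} p` are `D`. `[folklore]` -/
theorem primeFactors_prod_primes (hD : ∀ p ∈ D, p.Prime) : (∏ p ∈ D, p).primeFactors = D := by
  ext q
  rw [← Nat.support_factorization, Finsupp.mem_support_iff, factorization_prod_primes hD]
  split_ifs with h <;> simp [h]

/-- A prime divides `∏_{p ∈ D} p` iff it belongs to `D`. `[folklore]` -/
theorem dvd_prod_primes_iff (hD : ∀ p ∈ D, p.Prime) {q : ℕ} (hq : q.Prime) :
    q ∣ ∏ p ∈ D, p ↔ q ∈ D := by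
  constructor
  · intro hq'
    have : q ∈ (∏ p ∈ D, p).primeFactors :=
      Nat.mem_primeFactors.mpr ⟨hq, hq', prod_primes_ne_zero hD⟩
    rwa [primeFactors_prod_primes hD] at this
  · intro hqD
    exact Finset.dvd_prod_of_mem _ hqD

/-- The product of a set of multiplicative primes divides the conductor. `[folklore]` -/
theorem prod_dvd_conductorNorm
    (hD : D ⊆ (W.conductorNorm ℤ).primeFactors.filter (fun p => ¬ p ^ 2 ∣ W.conductorNorm ℤ)) :
    (∏ p ∈ D, p) ∣ W.conductorNorm ℤ :=
  Finset.prod_primes_dvd _ (fun _ hp => Nat.prime_iff.mp (prime_of_mem hD hp))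
    (fun _ hp => dvd_of_mem hD hp)

/-- `2^{#D} ≤ ∏_{p ∈ D} p` for a set of primes. `[folklore]` -/
theorem two_pow_card_le_prod (hD : ∀ p ∈ D, p.Prime) : 2 ^ D.card ≤ ∏ p ∈ D, p := by
  calc 2 ^ D.card = ∏ _p ∈ D, 2 := by simp
    _ ≤ ∏ p ∈ D, p := Finset.prod_le_prod' fun p hp => (hD p hp).two_le

/-- `2^{ω(D')} ≤ d(D')`: the subproducts of a product `D'` of distinct primes are distinct
divisors. `[folklore]` -/
theorem two_pow_card_le_card_divisors (hD : ∀ p ∈ D, p.Prime) :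
    2 ^ D.card ≤ (∏ p ∈ D, p).divisors.card := by
  classical
  rw [← Finset.card_powerset]
  refine Finset.card_le_card_of_injOn (fun S => ∏ p ∈ S, p) (fun S hS => ?_) ?_
  · rw [Finset.mem_coe, Nat.mem_divisors]
    exact ⟨Finset.prod_dvd_prod_of_subset _ _ _ (Finset.mem_powerset.mp hS), prod_primes_ne_zero hD⟩
  · intro S hS S' hS' h
    have hSp : ∀ p ∈ S, p.Prime := fun p hp => hD p (Finset.mem_powerset.mp hS hp)
    have hS'p : ∀ p ∈ S', p.Prime := fun p hp => hD p (Finset.mem_powerset.mp hS' hp)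
    have := primeFactors_prod_primes hSp
    rw [show (∏ p ∈ S, p) = ∏ p ∈ S', p from h, primeFactors_prod_primes hS'p] at this
    exact this.symm

/-- `φ(D') · 2^{ω(D')} ≥ D'` for a product `D'` of distinct primes (`2(p − 1) ≥ p`). `[folklore]` -/
theorem prod_le_totient_mul_two_pow (hD : ∀ p ∈ D, p.Prime) :
    (∏ p ∈ D, p) ≤ Nat.totient (∏ p ∈ D, p) * 2 ^ D.card := by
  classical
  induction D using Finset.induction_on with
  | empty => simp
  | insert p s hps ih =>
    have hp : p.Prime := hD p (Finset.mem_insert_self p s)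
    have hs : ∀ q ∈ s, q.Prime := fun q hq => hD q (Finset.mem_insert_of_mem hq)
    have hcop : Nat.Coprime p (∏ x ∈ s, x) := by
      refine (Nat.Prime.coprime_iff_not_dvd hp).mpr fun h => hps ?_
      exact (dvd_prod_primes_iff hs hp).mp h
    rw [Finset.prod_insert hps, Finset.card_insert_of_notMem hps, Nat.totient_mul hcop,
      Nat.totient_prime hp, pow_succ]
    calc p * ∏ x ∈ s, x ≤ ((p - 1) * 2) * (Nat.totient (∏ x ∈ s, x) * 2 ^ s.card) := by
          apply Nat.mul_le_mul _ (ih hs)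
          have := hp.two_le
          omega
      _ = (p - 1) * Nat.totient (∏ x ∈ s, x) * (2 ^ s.card * 2) := by ring

/-- `ψ(M) = gamma0Index M = M ∏_{p ∣ M} (1 + 1/p) ≥ M`. `[folklore]` -/
theorem le_gamma0Index (M : ℕ) (hM : M ≠ 0) : M ≤ gamma0Index M := by
  unfold gamma0Index
  conv_lhs => rw [← Nat.prod_factorization_pow_eq_self hM]
  unfold Finsupp.prod
  refine Finset.prod_le_prod' fun p hp => ?_
  have he : 1 ≤ M.factorization p := Nat.pos_of_ne_zero (Finsupp.mem_support_iff.mp hp)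
  calc p ^ M.factorization p = p ^ (M.factorization p - 1) * p := by
        rw [← pow_succ, Nat.sub_add_cancel he]
    _ ≤ p ^ (M.factorization p - 1) * (p + 1) := Nat.mul_le_mul_left _ (Nat.le_succ p)

end Arithmetic

/-- **A covering set gives an admissible factorisation.** If `D` is a set of multiplicative primes
of `W` of even cardinality (the first two clauses of the skeleton's `IsCoveringSet W D`), then
`N = D' · (N/D')`, `D' = ∏_{p ∈ D} p`, is an admissible factorisation
(`IsAdmissibleFactorization`: `D'` squarefree with evenly many prime factors, coprime to `N/D'`
because each `p ∈ D` divides `N` exactly once), and every multiplicative prime outside `D` divides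
the co-level `N/D'`. Registered (`stub-add`) representative of this helper file on stmt-ABC-1561, hence stated verbatim in
its one-line registered form. `[folklore]` -/
theorem admissible_of_isCoveringSet : ∀ {W : WeierstrassCurve ℚ} [W.IsElliptic] {D : Finset ℕ}, D ⊆ (W.conductorNorm ℤ).primeFactors.filter (fun p => ¬ p ^ 2 ∣ W.conductorNorm ℤ) → Even D.card → Literature.NumberTheory.Automorphic.IsAdmissibleFactorization (W.conductorNorm ℤ) (∏ p ∈ D, p) (W.conductorNorm ℤ / ∏ p ∈ D, p) ∧ (W.conductorNorm ℤ).primeFactors.filter (fun p => ¬ p ^ 2 ∣ W.conductorNorm ℤ) \ D ⊆ (W.conductorNorm ℤ / ∏ p ∈ D, p).primeFactors := by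
  intro W _ D hD heven
  have hprime : ∀ p ∈ D, p.Prime := fun p hp => prime_of_mem hD hp
  have hN : 0 < W.conductorNorm ℤ := W.conductorNorm_pos_holds
  have hdvd : (∏ p ∈ D, p) ∣ W.conductorNorm ℤ := prod_dvd_conductorNorm hD
  set N := W.conductorNorm ℤ with hNdef
  set D' := ∏ p ∈ D, p with hD'def
  have hD'0 : D' ≠ 0 := prod_primes_ne_zero hprime
  have hmul : D' * (N / D') = N := Nat.mul_div_cancel' hdvd
  have hM0 : N / D' ≠ 0 := fun h0 => by rw [h0, mul_zero] at hmul; exact hN.ne' hmul.symm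
  have hcop : Nat.Coprime D' (N / D') := by
    refine Nat.Coprime.prod_left fun p hp => (Nat.Prime.coprime_iff_not_dvd (hprime p hp)).mpr ?_
    intro hpM
    apply not_sq_dvd_of_mem hD hp
    have hpD : p ∣ D' := Finset.dvd_prod_of_mem _ hp
    rw [← hNdef, ← hmul, pow_two]
    exact mul_dvd_mul hpD hpM
  refine ⟨⟨hN, hmul, squarefree_prod_primes hprime, ?_, hcop⟩, ?_⟩
  · rwa [hD'def, primeFactors_prod_primes hprime]
  · intro q hq
    rw [Finset.mem_sdiff] at hq
    have hqm := Finset.mem_filter.mp hq.1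
    have hqp : q.Prime := Nat.prime_of_mem_primeFactors hqm.1
    have hqN : q ∣ N := Nat.dvd_of_mem_primeFactors hqm.1
    rw [Nat.mem_primeFactors]
    refine ⟨hqp, ?_, hM0⟩
    rw [← hmul] at hqN
    rcases (Nat.Prime.dvd_mul hqp).mp hqN with h1 | h2
    · exact absurd ((dvd_prod_primes_iff hprime hqp).mp h1) hq.2
    · exact h2



/-! ### Minimal Shimura parametrisation data -/

section Minimal

variable {D M : ℕ} {X : ShimuraCurveData D M}

/-- A curve with a Shimura parametrisation datum has one of minimal degree. `[folklore]` -/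
theorem exists_self_minimal {W : WeierstrassCurve ℚ} (P : ShimuraParametrizationData X W) :
    ∃ P' : ShimuraParametrizationData X W,
      ∀ P'' : ShimuraParametrizationData X W, P'.deg ≤ P''.deg := by
  classical
  have hex : ∃ d, ∃ P' : ShimuraParametrizationData X W, P'.deg = d := ⟨_, P, rfl⟩
  obtain ⟨P', hP'⟩ := Nat.find_spec hex
  exact ⟨P', fun P'' => hP' ▸ Nat.find_min' hex ⟨P'', rfl⟩⟩

/-- An isogeny class with a Shimura parametrisation datum has a datum realising `δ_{D,M}`
(`ShimuraParametrizationData.IsMinimalFor`). `[folklore]` -/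
theorem exists_class_minimal {W : WeierstrassCurve ℚ} [W.IsElliptic]
    (P : ShimuraParametrizationData X W) :
    ∃ (W' : WeierstrassCurve ℚ) (_ : W'.IsElliptic) (P' : ShimuraParametrizationData X W'),
      P'.IsMinimalFor W := by
  classical
  have hex : ∃ d, ∃ (W' : WeierstrassCurve ℚ) (_ : W'.IsElliptic)
      (P' : ShimuraParametrizationData X W'), W.IsIsogenous W' ∧ P'.deg = d :=
    ⟨_, W, inferInstance, P, WeierstrassCurve.IsIsogenous.refl_holds W, rfl⟩
  obtain ⟨W', hW', P', hiso, hP'⟩ := Nat.find_spec hex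
  refine ⟨W', hW', P', hiso, fun W'' _ P'' hiso'' => ?_⟩
  rw [hP']
  exact Nat.find_min' hex ⟨W'', inferInstance, P'', hiso'', rfl⟩

end Minimal

/-! ### Real bookkeeping (Pasten §16) -/

section RealChain

open Real

/-- **The multiplicative chain of Pasten's §16.** From `T · (a δ) = δ₁ b` (Thm 6.1 (b)), `a ≥ 1`,
`b ≤ κ^ω`, `d' ≤ 163 δ` (Mazur–Kenku), `S = d' V` (Frey's identity on the Shimura curve),
`V ≤ 163 V₀` (Faltings heights in an isogeny class), `4π² c₀² (f,f) = δ₁ V₀` (Zagier), `|c₀| ≤ 𝓜`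
(Manin constant) and `(f,f) ≤ C_p X`: `T ≤ (4π² 𝓜² C_p 163²) κ^ω X / S`. `[folklore]` -/
theorem real_chain {T δ₁ δ d' a b κω S V V₀ ff c₀ 𝓜 Cp X : ℝ}
    (hT : T * (a * δ) = δ₁ * b) (ha : 1 ≤ a) (hb0 : 0 ≤ b) (hb : b ≤ κω) (hδ : 0 < δ) (hT0 : 0 ≤ T)
    (hδ₁ : 0 ≤ δ₁) (hd' : d' ≤ 163 * δ) (hd'0 : 0 < d') (hS : S = d' * V) (hV : 0 < V)
    (hV₀ : 0 < V₀) (hVV : V ≤ 163 * V₀)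
    (hz : 4 * π ^ 2 * c₀ ^ 2 * ff = δ₁ * V₀) (hc : |c₀| ≤ 𝓜) (hff0 : 0 ≤ ff) (hff : ff ≤ Cp * X) :
    T ≤ (4 * π ^ 2 * 𝓜 ^ 2 * Cp * 163 ^ 2) * κω * X / S := by
  have hS0 : 0 < S := by rw [hS]; positivity
  have h𝓜 : 0 ≤ 𝓜 := (abs_nonneg _).trans hc
  -- step 1: T ≤ δ₁ κω / δ
  have h1 : T * δ ≤ δ₁ * κω := by
    calc T * δ ≤ T * (a * δ) := by nlinarith [mul_nonneg hT0 hδ.le]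
      _ = δ₁ * b := hT
      _ ≤ δ₁ * κω := mul_le_mul_of_nonneg_left hb hδ₁
  -- step 2: δ₁ V₀ ≤ 4π² 𝓜² Cp X
  have h2 : δ₁ * V₀ ≤ 4 * π ^ 2 * 𝓜 ^ 2 * (Cp * X) := by
    rw [← hz]
    have hc2 : c₀ ^ 2 ≤ 𝓜 ^ 2 := by
      rw [← sq_abs c₀]; exact pow_le_pow_left₀ (abs_nonneg _) hc 2
    have : 4 * π ^ 2 * c₀ ^ 2 * ff ≤ 4 * π ^ 2 * 𝓜 ^ 2 * ff := by
      have hπ : 0 ≤ 4 * π ^ 2 := by positivity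
      nlinarith [mul_nonneg hπ hff0]
    calc 4 * π ^ 2 * c₀ ^ 2 * ff ≤ 4 * π ^ 2 * 𝓜 ^ 2 * ff := this
      _ ≤ 4 * π ^ 2 * 𝓜 ^ 2 * (Cp * X) := by
          apply mul_le_mul_of_nonneg_left hff; positivity
  -- step 3: S ≤ 163² V₀ δ
  have h3 : S ≤ 163 ^ 2 * V₀ * δ := by
    rw [hS]
    calc d' * V ≤ (163 * δ) * (163 * V₀) := mul_le_mul hd' hVV hV.le (by positivity)
      _ = 163 ^ 2 * V₀ * δ := by ring
  rw [le_div_iff₀ hS0]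
  have hκω : 0 ≤ κω := hb0.trans hb
  calc T * S ≤ T * (163 ^ 2 * V₀ * δ) := mul_le_mul_of_nonneg_left h3 hT0
    _ = 163 ^ 2 * V₀ * (T * δ) := by ring
    _ ≤ 163 ^ 2 * V₀ * (δ₁ * κω) := by apply mul_le_mul_of_nonneg_left h1; positivity
    _ = 163 ^ 2 * κω * (δ₁ * V₀) := by ring
    _ ≤ 163 ^ 2 * κω * (4 * π ^ 2 * 𝓜 ^ 2 * (Cp * X)) := by
        apply mul_le_mul_of_nonneg_left h2; positivity
    _ = (4 * π ^ 2 * 𝓜 ^ 2 * Cp * 163 ^ 2) * κω * X := by ring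

/-- **The logarithmic chain of Pasten's §16.** From `1 ≤ T ≤ K κ^ω N^{1+η} / S`, `1 ≤ κ ≤ 2^κ`,
the divisor bound `2^ω ≤ C_η N^η` and the volume bound `(π/3) N ≤ vol · 2^ω`:
`log T ≤ (log K + (κ+1) log C_η + log(3/π)) + (κ+2) η log N + log vol − log S`. `[folklore]` -/
theorem log_chain {T K κ S vol Nr Cη η twoω : ℝ} {ω : ℕ}
    (hT1 : 1 ≤ T) (hT : T ≤ K * κ ^ ω * Nr ^ (1 + η) / S) (hK : 0 < K) (hS : 0 < S)
    (hκ : 1 ≤ κ) (hκ2 : κ ≤ 2 ^ κ) (hN : 1 ≤ Nr) (hCη : 1 ≤ Cη)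
    (htwo : twoω = 2 ^ ω) (hdiv : twoω ≤ Cη * Nr ^ η) (hvol0 : 0 < vol)
    (hvol : π / 3 * Nr ≤ vol * twoω) :
    Real.log T ≤ (Real.log K + (κ + 1) * Real.log Cη + Real.log (3 / π)) +
      (κ + 2) * η * Real.log Nr + Real.log vol - Real.log S := by
  have hNpos : 0 < Nr := by linarith
  have hlogN : 0 ≤ Real.log Nr := Real.log_nonneg hN
  have htwo0 : 0 < twoω := by rw [htwo]; positivity
  have hκ0 : 0 < κ := by linarith
  -- log of the product bound
  have hRHS : 0 < K * κ ^ ω * Nr ^ (1 + η) / S := by positivity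
  have l1 : Real.log T ≤ Real.log K + ω * Real.log κ + (1 + η) * Real.log Nr - Real.log S := by
    have := Real.log_le_log (by linarith) hT
    rw [Real.log_div (by positivity) hS.ne', Real.log_mul (by positivity) (by positivity),
      Real.log_mul hK.ne' (by positivity), Real.log_pow, Real.log_rpow hNpos] at this
    linarith
  -- ω log 2 ≤ log Cη + η log N
  have l2 : (ω : ℝ) * Real.log 2 ≤ Real.log Cη + η * Real.log Nr := by
    have := Real.log_le_log htwo0 hdiv
    rw [htwo, Real.log_pow, Real.log_mul (by positivity) (by positivity), Real.log_rpow hNpos] at this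
    exact this
  -- log κ ≤ κ log 2
  have l3 : Real.log κ ≤ κ * Real.log 2 := by
    have := Real.log_le_log hκ0 hκ2
    rwa [Real.log_rpow two_pos] at this
  -- ω log κ ≤ κ (log Cη + η log N)
  have l4 : (ω : ℝ) * Real.log κ ≤ κ * (Real.log Cη + η * Real.log Nr) := by
    calc (ω : ℝ) * Real.log κ ≤ ω * (κ * Real.log 2) :=
          mul_le_mul_of_nonneg_left l3 (Nat.cast_nonneg ω)
      _ = κ * (ω * Real.log 2) := by ring
      _ ≤ κ * (Real.log Cη + η * Real.log Nr) := mul_le_mul_of_nonneg_left l2 hκ0.le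
  -- log N ≤ log vol + log twoω + log (3/π)
  have l5 : Real.log Nr ≤ Real.log vol + ω * Real.log 2 + Real.log (3 / π) := by
    have h := Real.log_le_log (by positivity) hvol
    rw [Real.log_mul (by positivity) hNpos.ne', Real.log_mul hvol0.ne' htwo0.ne', htwo,
      Real.log_pow, Real.log_div Real.pi_pos.ne' three_ne_zero] at h
    rw [Real.log_div three_ne_zero Real.pi_pos.ne']
    linarith
  have hlogCη : 0 ≤ Real.log Cη := Real.log_nonneg hCη
  nlinarith [l1, l2, l4, l5, mul_nonneg hκ0.le hlogCη]

end RealChain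

end Summit.ABC.ABC.Theorems.ManyPrimeValuationProduct.JLPackage

end
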